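import Summits.CriticalPhenomena.PercolationContinuityZ3.Theses.PercClusterResistance
import Literature.Probability.Percolation.SupercriticalClusterTransienceProofs

/-!
# Birth skeleton (BC3) for the crux `ClusterTransient` (stmt-CriticalPhenomena-5591)

Route `route-CriticalPhenomena-PercClusterResistance` (sub-problem `PercolationContinuityZ3`), crux decl
`Summit.CriticalPhenomena.PercolationContinuityZ3.Theses.PercClusterResistance.ClusterTransient` (rank 3):
for every `p ∈ [0,1]` with `θ(p) > 0`, for `P_p`-a.e. `ω` with `|C(0)| = ∞` the open subgraph of `ℤ³`
carries a unit flow from `0` to `∞` of finite energy (antisymmetric, supported on open nearest-neighbour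
edges, Kirchhoff off `0`, out-flow `1` at `0`, `Σ f² < ∞`) — T. Lyons' flow form of "simple random
walk on `C(0)` is transient" (Lyons–Peres 2016 Thm 2.11). For `p > p_c(ℤ³)` this is
Grimmett–Kesten–Zhang 1993, PROVED in tree (`GrimmettKestenZhang1993_flow_holds`,
`Literature/Probability/Percolation/SupercriticalClusterTransienceProofs.lean`); for `p < p_c` it is
vacuous (`theta_eq_zero_of_lt_criticalProb_holds`); the whole content is a hypothetically percolating
`p = p_c` (Lyons–Peres Conj. 6.44 on `ℤ³`).

THE LINE — **GKZ at the same `p`**. The in-tree discharge of GKZ is modular: everything after the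
choice of constants runs on a `GKZ.Setup d` (a density `p` together with the two quantitative inputs
of GKZ's Proposition 4 AT THAT `p` — Lemma 5, seeds: `P_p(v + B(m) ↮ ∞) ≤ e^{-γ m}`; Lemma 6, orange
peeling / local uniqueness: `P_p(A_k(x,y)) ≤ ρ^k`), and `p > p_c` enters ONLY through
`GKZ.exists_setup`, i.e. through the Grimmett–Marstrand slab proofs of Lemmas 5 and 6. The skeleton
cuts the crux exactly there: two registered stubs say that `θ(p) > 0` ALONE already forces the two
inputs at the same `p`, and the composition `ClusterTransient_of` is the GKZ engine re-run on the
resulting setup (tree of tubes, Prop. 3 flow, Borel–Cantelli Prop. 4, re-rooting at `0` by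
Aizenman–Kesten–Newman/Burton–Keane uniqueness, which holds at EVERY `p`) — kernel-checked, no `sorry`
outside the stubs.

* STUB 1 `stub_seedDecay` (L at `p > p_c`: in tree; OPEN at a percolating `p_c`): `SeedDecay` —
  for every `p` with `θ(p) > 0` there is `γ > 0` with `P_p(no vertex of v + B(m) is in an infinite
  cluster) ≤ e^{-γ m}` for all centres `v` and radii `m` (GKZ Lemma 5 with the hypothesis `p > p_c`
  replaced by `θ(p) > 0`: an exponential lower tail for the density of the infinite cluster in boxes).
* STUB 2 `stub_peelDecay` (XL; OPEN at a percolating `p_c` — LOAD-BEARING / hardest): `PeelDecay` —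
  for every `p` with `θ(p) > 0` there are a shell thickness `M ≥ 1` and `ρ < 1` with
  `P_p(A_k(x,y)) ≤ ρ^k` for all `v, n, k` and `x, y ∈ v + B(n)`, where
  `A_k(x,y) = {x, y ↔ v + ∂B(n + (k+1)M) through the inside} ∩ {x ↮ y inside v + B(n + (k+1)M − 1)}`
  (`GKZ.Apeel`; GKZ Lemma 6 = Grimmett 1999 Lemma (7.89), with `p > p_c` replaced by `θ(p) > 0`:
  geometric decay, in the number of shells, of "two long arms not glued locally" — quantitative local
  uniqueness of the infinite cluster at the same `p`).

Composition (kernel-checked): `ClusterTransient_of : stub_seedDecay → stub_peelDecay → ClusterTransient`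
(hypotheses typed by the name-keyed aliases `__Registered.stub_*`), through `exists_setup_of` (the
constants `b, m₀` with `e^{-γ b}, ρ^{m₀} ≤ 1/16`, as in `GKZ.exists_setup`) and `flowAt_of_setup`
(= the body of `GKZ.ae_exists_flow`, which never looks at `p > p_c` once the setup exists).

HONEST PIECES. Both stubs, like the crux, are consequences of the conjunct `θ(p_c) = 0`
(`seedDecay_of_continuity`, `peelDecay_of_continuity`, `flowAt_of_continuity` below: under
the conjunct `θ(p) > 0` forces `p > p_c`, where Lemmas 5–6 and GKZ are in tree), hence predicted TRUE
and refutable only by refuting the conjunct; neither is a consequence of the crux (quantitative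
connectivity decay is not implied by the existence of a flow) and neither gives the crux or the
conjunct on its own (BC3 probes `bc/stub_*_probe.lean`: all fail). In a hypothetical jump world they
are exactly the two places where GKZ's proof stalls: `C` has `p_c(C) = 1`-type fragility, half-spaces
and slabs do not percolate at `p_c` (Barsky–Grimmett–Newman), so neither the slab seeds of Lemma 5 nor
the slab connections (7.78) behind Lemma 6 exist — a proof of either stub must be `θ`-blind
(density + uniqueness + insertion tolerance), which is the route's declared bet (header BARRIERS:
SprinklingRenormalisation "not evaded").

DISPROOF USED: none exists for this crux (no `Cruxes/ClusterTransient/` directory before this file: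
no `Disproof.lean`, no `Lines/`, no landed Negative lemma, 2026-08-17); negatives index of the summit:
no flow / random-walk / seed / peeling statement. Weaker inputs would do with a re-engineered engine
(polynomial rates `m^{-c}`, `c > 2`, suffice if the tube radii grow geometrically `λ^k`, `λ < 2`,
instead of linearly — energy `Σ_k 2^{-k} d_k < ∞`), but the composition must be proved NOW, so the
stubs are typed to the engine that exists (`GKZ.Setup`); the polynomial variant is a later line.
-/

noncomputable section

namespace Summit.CriticalPhenomena.PercolationContinuityZ3.Cruxes.ClusterTransient.Birth

open MeasureTheory ProbabilityTheory Filter SimpleGraph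
open Literature.Probability.LatticeModels Literature.Probability.Percolation
open Literature.Probability.Percolation.GM (ball)
open Literature.Probability.Percolation.GKZ (noPercolation Apeel Setup)
open Summit.CriticalPhenomena.PercolationContinuityZ3.Theses.PercClusterResistance (ClusterTransient)
open scoped ENNReal Classical Topology

/-! ## Objects of the line -/

/-- The bond percolation measure `P_p` on `ℤ³`. -/
abbrev μ (p : unitInterval) : Measure (BondConfig (Site 3)) := bondPercolation (zdGraph 3) p

/-- The percolation probability `θ(p) = P_p(|C(0)| = ∞)` on `ℤ³`. -/
abbrev θ (p : unitInterval) : ℝ := theta (zdGraph 3) (0 : Site 3) p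

/-- `FlowAt p`: for `P_p`-a.e. `ω` with `|C(0)| = ∞` there is a finite-energy unit flow from `0` on the
open subgraph (verbatim the conclusion of the crux at the density `p`). -/
def FlowAt (p : unitInterval) : Prop :=
  ∀ᵐ ω ∂(μ p), ω ∈ percolatesAt (0 : Site 3) →
    ∃ f : Site 3 → Site 3 → ℝ,
      (∀ x y, f x y = -f y x) ∧
      (∀ x y, f x y ≠ 0 → (zdGraph 3).Adj x y ∧ s(x, y) ∈ ω) ∧
      (∀ x, x ≠ 0 → ∑ y ∈ (zdGraph 3).neighborFinset x, f x y = 0) ∧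
      ∑ y ∈ (zdGraph 3).neighborFinset 0, f 0 y = 1 ∧
      Summable (fun q : Site 3 × Site 3 => f q.1 q.2 ^ 2)

/-- The crux is literally `∀ p, θ(p) > 0 → FlowAt p`. -/
theorem clusterTransient_iff : ClusterTransient ↔ ∀ p : unitInterval, 0 < θ p → FlowAt p := Iff.rfl

/-! ## The two stub statements -/

/-- STUB 1 statement (GKZ Lemma 5 at the same `p`): exponential seeds from `θ(p) > 0` alone. -/
def SeedDecay : Prop :=
  ∀ p : unitInterval, 0 < θ p → ∃ γ : ℝ, 0 < γ ∧ ∀ (v : Site 3) (m : ℕ),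
    (μ p).real (noPercolation (ball v m)) ≤ Real.exp (-(γ * m))

/-- STUB 2 statement (GKZ Lemma 6 / Grimmett (7.89) at the same `p`): geometric orange peeling from
`θ(p) > 0` alone. -/
def PeelDecay : Prop :=
  ∀ p : unitInterval, 0 < θ p → ∃ M : ℕ, 1 ≤ M ∧ ∃ ρ : ℝ, 0 ≤ ρ ∧ ρ < 1 ∧
    ∀ (v : Site 3) (n k : ℕ) (x y : Site 3), x ∈ ball v n → y ∈ ball v n →
      (μ p).real (Apeel v n M k x y) ≤ ρ ^ k

/-! ## Registered stubs -/

/-- **STUB 1 `seedDecay`** (OPEN at a percolating `p_c`; the case `p > p_c` is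
`GKZ.exists_real_noPercolation_ball_le_exp`, in tree): for every `p` with `θ(p) > 0` there is `γ > 0`
such that `P_p(v + B(m) ↮ ∞) ≤ e^{-γ m}` for all `v ∈ ℤ³`, `m ∈ ℕ`. Why it might fail (as a provable
statement): the only proofs of seed decay use percolation in slabs (Grimmett–Marstrand, i.e.
sprinkling), void at a percolating `p_c` where slabs do not percolate (BGN); `θ`-blindly only
`P_p(v + B(m) ↮ ∞) → 0` (ergodic density `θ`) is available, with no rate. -/
theorem stub_seedDecay : SeedDecay := by
  sorry

/-- **STUB 2 `peelDecay`** (OPEN at a percolating `p_c` — LOAD-BEARING; the case `p > p_c` is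
`GKZ.exists_peel_bound`, in tree): for every `p` with `θ(p) > 0` there are `M ≥ 1` and `0 ≤ ρ < 1` with
`P_p(A_k(x,y)) ≤ ρ^k` (`GKZ.Apeel v n M k x y`) for all `v, n, k` and `x, y ∈ v + B(n)`. Why it might
fail: every shell of thickness `M` must glue two long arms with probability `≥ 1 − ρ` uniformly in
the past shells — Grimmett's (7.78) slab connections, sprinkling again; at a percolating `p_c` local
uniqueness is a two-arm statement about a fragile cluster (`p_c(C) = 1`-type, finite half-space
pieces), and no sprinkling-free local-uniqueness estimate is in print even for `p > p_c`. -/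
theorem stub_peelDecay : PeelDecay := by
  sorry

/-! ### Name-keyed aliases of the stub statements
`__Registered.stub_X` is statement `X` under the registered stub's short name, so that the native skeleton
audit accepts `ClusterTransient_of : __Registered.stub_… → … → ClusterTransient` with hypotheses keyed BY
NAME (device of `Cruxes/BGNOffTheFloor/Lines/birth.lean`; the `@[stub]` attribute is gate-reserved). -/
namespace __Registered

/-- Alias of `SeedDecay` keyed by the registered stub name. -/
abbrev stub_seedDecay : Prop := SeedDecay
/-- Alias of `PeelDecay` keyed by the registered stub name. -/
abbrev stub_peelDecay : Prop := PeelDecay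

end __Registered

/-! ## Proved plumbing I: the stubs and the crux are consequences of the conjunct (honest pieces) -/

/-- Under `θ(p) > 0` we have `p ≥ p_c`; under the conjunct `θ(p_c) = 0` moreover `p ≠ p_c`. -/
theorem criticalProb_lt_of_theta_pos (hS : _root_.PercolationContinuityZ3) (p : unitInterval)
    (hθ : 0 < θ p) : (criticalProbI 3 : ℝ) < p := by
  rcases lt_trichotomy (criticalProbI 3 : ℝ) p with h | h | h
  · exact h
  · exfalso
    have hp : p = criticalProbI 3 := Subtype.ext h.symm
    rw [hp] at hθ
    have hS' : theta (zdGraph 3) (0 : Site 3) (criticalProbI 3) = 0 := hS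
    exact hθ.ne' hS'
  · exfalso
    have h0 : theta (zdGraph 3) (0 : Site 3) p = 0 :=
      theta_eq_zero_of_lt_criticalProb_holds (zdGraph 3) (0 : Site 3) p (by simpa using h)
    exact hθ.ne' h0

/-- The case `p > p_c` of STUB 1 is GKZ Lemma 5, in tree. -/
theorem seedDecay_of_gt (p : unitInterval) (hp : (criticalProbI 3 : ℝ) < p) :
    ∃ γ : ℝ, 0 < γ ∧ ∀ (v : Site 3) (m : ℕ),
      (μ p).real (noPercolation (ball v m)) ≤ Real.exp (-(γ * m)) :=
  GKZ.exists_real_noPercolation_ball_le_exp (d := 3) le_rfl p (by simpa using hp)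

/-- The case `p > p_c` of STUB 2 is GKZ Lemma 6 / Grimmett (7.89), in tree. -/
theorem peelDecay_of_gt (p : unitInterval) (hp : (criticalProbI 3 : ℝ) < p) :
    ∃ M : ℕ, 1 ≤ M ∧ ∃ ρ : ℝ, 0 ≤ ρ ∧ ρ < 1 ∧
      ∀ (v : Site 3) (n k : ℕ) (x y : Site 3), x ∈ ball v n → y ∈ ball v n →
        (μ p).real (Apeel v n M k x y) ≤ ρ ^ k := by
  obtain ⟨L, -, ρ, hρ0, hρ1, h⟩ := GKZ.exists_peel_bound (d := 3) le_rfl p (by simpa using hp)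
  exact ⟨L + 1, Nat.succ_pos L, ρ, hρ0, hρ1, h⟩

/-- STUB 1 follows from the conjunct. -/
theorem seedDecay_of_continuity (hS : _root_.PercolationContinuityZ3) : SeedDecay :=
  fun p hθ => seedDecay_of_gt p (criticalProb_lt_of_theta_pos hS p hθ)

/-- STUB 2 follows from the conjunct. -/
theorem peelDecay_of_continuity (hS : _root_.PercolationContinuityZ3) : PeelDecay :=
  fun p hθ => peelDecay_of_gt p (criticalProb_lt_of_theta_pos hS p hθ)

/-- The content of the crux follows from the conjunct (info for BC2's converse direction `S → C`:
the crux is a consequence of the sub-statement and is used toward it by `closes`; stated through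
`FlowAt`, so that `ClusterTransient_of` stays the only theorem concluding the crux decl by name). -/
theorem flowAt_of_continuity (hS : _root_.PercolationContinuityZ3) (p : unitInterval) (hθ : 0 < θ p) :
    FlowAt p :=
  GrimmettKestenZhang1993_flow_holds.three p (criticalProb_lt_of_theta_pos hS p hθ)

/-! ## Proved plumbing II: the GKZ engine at a fixed density -/

/-- **The constants** (as in `GKZ.exists_setup`, minus `p > p_c`): the two stub inputs at `p` give a
`GKZ.Setup 3` at `p` (`b` with `e^{-γ b} ≤ 1/16`, `m₀` with `ρ^{m₀} ≤ 1/16`). -/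
theorem exists_setup_of (hseed : SeedDecay) (hpeel : PeelDecay) (p : unitInterval) (hθ : 0 < θ p) :
    ∃ S : Setup 3, S.p = p := by
  obtain ⟨γ, hγ, hs⟩ := hseed p hθ
  obtain ⟨M, hM, ρ, hρ0, hρ1, hpl⟩ := hpeel p hθ
  -- `b` with `e^{-γ b} ≤ 1/16`
  obtain ⟨b, hb⟩ : ∃ b : ℕ, 1 ≤ b ∧ Real.exp (-(γ * b)) ≤ 1 / 16 := by
    have ht : Tendsto (fun n : ℕ => Real.exp (-(γ * n))) atTop (𝓝 0) := by
      have h1 : Tendsto (fun n : ℕ => γ * n) atTop atTop :=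
        Tendsto.const_mul_atTop hγ tendsto_natCast_atTop_atTop
      exact Real.tendsto_exp_neg_atTop_nhds_zero.comp h1
    obtain ⟨N, hN⟩ :=
      (ht.eventually (eventually_le_nhds (by norm_num : (0 : ℝ) < 1 / 16))).exists_forall_of_atTop
    exact ⟨max N 1, le_max_right _ _, hN _ (le_max_left _ _)⟩
  -- `m₀` with `ρ^{m₀} ≤ 1/16`
  obtain ⟨m₀, hm₀⟩ : ∃ m₀ : ℕ, ρ ^ m₀ ≤ 1 / 16 := by
    have ht : Tendsto (fun n : ℕ => ρ ^ n) atTop (𝓝 0) := tendsto_pow_atTop_nhds_zero_of_lt_one hρ0 hρ1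
    obtain ⟨N, hN⟩ :=
      (ht.eventually (eventually_le_nhds (by norm_num : (0 : ℝ) < 1 / 16))).exists_forall_of_atTop
    exact ⟨N, hN N le_rfl⟩
  -- measure form of the seed bound
  have hs' : ∀ (v : Site 3) (m : ℕ),
      bondPercolation (zdGraph 3) p (noPercolation (ball v m)) ≤ ENNReal.ofReal (Real.exp (-(γ * m))) := by
    intro v m
    rw [← ofReal_measureReal]
    exact ENNReal.ofReal_le_ofReal (hs v m)
  exact ⟨⟨p, b, m₀, M, γ, ρ, hb.1, hM, hρ0, hs', hb.2, hpl, hm₀⟩, rfl⟩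

/-- **The engine** (GKZ Propositions 3–4 and the re-rooting at `0`, = the body of
`GKZ.ae_exists_flow`): a setup at `p` gives `FlowAt p`. No use of `p > p_c`: uniqueness of the
infinite cluster (`Grimmett1999_numInfiniteClusters_le_one_holds`) holds at every `p`. -/
theorem flowAt_of_setup (S : Setup 3) : FlowAt S.p := by
  have hd : 3 ≤ 3 := le_rfl
  unfold FlowAt
  have hE : ∀ᵐ ω ∂(bondPercolation (zdGraph 3) S.p), ω ⊆ (zdGraph 3).edgeSet := setBernoulli_ae_subset
  filter_upwards [hE, Grimmett1999_numInfiniteClusters_le_one_holds 3 S.p, S.ae_eventually_genGood]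
    with ω hωE hU hgood
  intro h0
  obtain ⟨K₀, hK₀⟩ := eventually_atTop.1 hgood
  set K := max K₀ 1 with hK
  have hG : S.GoodFrom ω K := ⟨hωE, le_max_right _ _, fun k hk => hK₀ k ((le_max_left _ _).trans hk)⟩
  obtain ⟨f, hanti, hsupp, hkir, hsum⟩ := S.exists_flow_rootPt hd hG
  set z₀ := S.zD ω K GKZ.rootD with hz₀
  -- an open path from `0` to `z₀` by uniqueness of the infinite cluster (valid at every `p`)
  have hz₀perc : ω ∈ percolatesAt z₀ := (S.zD_spec hG GKZ.rootD).2
  have hreach : (openGraph ω).Reachable 0 z₀ :=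
    (numInfiniteClusters_le_one_iff ω).1 hU 0 z₀ h0 hz₀perc
  obtain ⟨γ, -, hγ⟩ := exists_walk_of_mem_openConnIn hωE (openConnIn_univ_of_reachable hreach)
  refine ⟨fun x y => f x y + GKZ.walkFlow γ x y, fun x y => ?_, fun x y hxy => ?_, fun x hx => ?_, ?_,
    GKZ.summable_sq_add_walkFlow hsum γ⟩
  · show f x y + GKZ.walkFlow γ x y = -(f y x + GKZ.walkFlow γ y x)
    rw [hanti x y, GKZ.walkFlow_antisymm γ x y]; ring
  · have hxy : f x y + GKZ.walkFlow γ x y ≠ 0 := hxy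
    by_cases hf : f x y = 0
    · rw [hf, zero_add] at hxy
      exact ⟨GKZ.adj_of_walkFlow_ne_zero γ hxy, hγ _ (GKZ.mem_edges_of_walkFlow_ne_zero γ hxy)⟩
    · exact hsupp x y hf
  · show ∑ y ∈ (zdGraph 3).neighborFinset x, (f x y + GKZ.walkFlow γ x y) = 0
    rw [GKZ.sum_add_walkFlow hkir γ x, if_neg hx]
  · show ∑ y ∈ (zdGraph 3).neighborFinset 0, (f 0 y + GKZ.walkFlow γ 0 y) = 1
    rw [GKZ.sum_add_walkFlow hkir γ 0, if_pos rfl]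

/-- Both stub statements together give the flow at every percolating density. -/
theorem flowAt_of (hseed : SeedDecay) (hpeel : PeelDecay) (p : unitInterval) (hθ : 0 < θ p) :
    FlowAt p := by
  obtain ⟨S, hS⟩ := exists_setup_of hseed hpeel p hθ
  have h := flowAt_of_setup S
  rw [hS] at h
  exact h

/-! ## The composition, by name -/

/-- **`ClusterTransient_of`**: the two registered stubs imply the crux
`Summit.CriticalPhenomena.PercolationContinuityZ3.Theses.PercClusterResistance.ClusterTransient`
(kernel-checked; no `sorry` outside the stubs). -/
theorem ClusterTransient_of (hseed : __Registered.stub_seedDecay) (hpeel : __Registered.stub_peelDecay) :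
    Summit.CriticalPhenomena.PercolationContinuityZ3.Theses.PercClusterResistance.ClusterTransient :=
  clusterTransient_iff.2 (flowAt_of hseed hpeel)

/-- Wiring check: the registered stubs feed `ClusterTransient_of` as stated. -/
example : Summit.CriticalPhenomena.PercolationContinuityZ3.Theses.PercClusterResistance.ClusterTransient :=
  ClusterTransient_of stub_seedDecay stub_peelDecay

end Summit.CriticalPhenomena.PercolationContinuityZ3.Cruxes.ClusterTransient.Birth

end
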